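import Mathlib
import Literature.Analysis.Calculus.TwoVariablePartials
import HarnessLib

/-!
# The Darboux ladder `D_n = (∂ₓ − n ι) ∘ ⋯ ∘ (∂ₓ − ι)` of the inverse-square potentials

Analysis/ODE definitions file. For a coefficient function `ι : ℝ → ℝ` (in applications smooth on `ℝ`
and equal to `1/(x − x₀)` on a half-line `x > x₀ + ½`, where `ι' = −ι²`) we define the first-order
operators and their composite

  `ladderStep ι k f = f' − k ι f`,   `ladder ι n = ladderStep ι n ∘ ⋯ ∘ ladderStep ι 1`

(`ladder ι 0 f = f`). Where `ι = 1/x` these are the classical intertwining (Infeld–Hull / Crum–Darboux)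
operators `a_k = ∂ₓ − k/x` with `−a_k† a_k = ∂² − k(k+1)/x²`, `−a_k a_k† = ∂² − (k−1)k/x²`, so that
`D_n` maps solutions of the free 1+1 wave equation to solutions of `ψ_tt − ψ_xx + n(n+1)x⁻²ψ = 0`
(equivalently: the descent `u ↦ (r⁻¹∂ᵣ)ⁿ` from `1` to `2n+1` space dimensions for radial waves,
Kenig–Lawrie–Liu–Schlag, Adv. Math. 285 (2015), §2). This file records the definitions and their
elementary calculus: unfolding lemmas, `Cᵐ`-regularity (one derivative lost per rung), linearity, and
the joint regularity / time-differentiation rules for one-parameter families `t ↦ ladder ι n (Φ t)`.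
The wave-equation intertwining itself is `Literature.Analysis.PDE.wave1D_intertwine`
(`Wave1DIntertwining.lean`); the explicit inverse rungs are in `FirstOrderLinearRightInverse.lean`.
Motivation: far-side (photon-sphere / null-infinity) channel estimate of `FixedModeChannels`
(route PhotonSphereChannels, stmt-FinalStateConjecture-10048).
-/

noncomputable section

namespace Literature.Analysis.ODE

open Set Filter Topology

/-- One rung of the Darboux ladder: `ladderStep ι k f = f' − k·ι·f` (for `ι = 1/x` this is the
intertwining operator `a_k = ∂ₓ − k/x` of the inverse-square potentials `(k−1)k/x²` and `k(k+1)/x²`).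
[cite: KenigEtAl2015, §2] -/
def ladderStep (ι : ℝ → ℝ) (k : ℕ) (f : ℝ → ℝ) : ℝ → ℝ :=
  fun x => deriv f x - k * ι x * f x

/-- The Darboux ladder `ladder ι n = ladderStep ι n ∘ ⋯ ∘ ladderStep ι 1` (`ladder ι 0 f = f`); for
`ι = 1/x` it maps free waves to solutions of `ψ_tt − ψ_xx + n(n+1)x⁻²ψ = 0`.
[cite: KenigEtAl2015, §2] -/
def ladder (ι : ℝ → ℝ) : ℕ → (ℝ → ℝ) → ℝ → ℝ
  | 0 => fun f => f
  | n + 1 => fun f => ladderStep ι (n + 1) (ladder ι n f)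

variable {ι : ℝ → ℝ}

/-- `ladder_zero`. [folklore] -/
@[simp] theorem ladder_zero (f : ℝ → ℝ) : ladder ι 0 f = f := rfl

/-- `ladder_succ`. [folklore] -/
theorem ladder_succ (n : ℕ) (f : ℝ → ℝ) :
    ladder ι (n + 1) f = ladderStep ι (n + 1) (ladder ι n f) := rfl

/-- `ladderStep_apply`. [folklore] -/
theorem ladderStep_apply (k : ℕ) (f : ℝ → ℝ) (x : ℝ) :
    ladderStep ι k f x = deriv f x - k * ι x * f x := rfl

/-! ### Regularity: one derivative per rung -/

/-- `f ∈ C^{m+1}`, `ι ∈ C^m` ⇒ `ladderStep ι k f ∈ C^m`. [folklore] -/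
theorem contDiff_ladderStep {m : ℕ} (hι : ContDiff ℝ m ι) {f : ℝ → ℝ} (hf : ContDiff ℝ (m + 1) f)
    (k : ℕ) : ContDiff ℝ m (ladderStep ι k f) := by
  have hd : ContDiff ℝ m (deriv f) := (contDiff_succ_iff_deriv.1 hf).2.2
  have hf' : ContDiff ℝ m f := hf.of_le (by exact_mod_cast Nat.le_succ m)
  exact hd.sub ((contDiff_const.mul hι).mul hf')

/-- `f ∈ C^{m+n}`, `ι ∈ C^∞` ⇒ `ladder ι n f ∈ C^m`. [folklore] -/
theorem contDiff_ladder (hι : ContDiff ℝ (⊤ : ℕ∞) ι) {m n : ℕ} {f : ℝ → ℝ}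
    (hf : ContDiff ℝ ((m + n : ℕ) : ℕ∞) f) : ContDiff ℝ m (ladder ι n f) := by
  induction n generalizing m with
  | zero => simpa using hf
  | succ n ih =>
    rw [ladder_succ]
    have hf' : ContDiff ℝ ((m + 1 + n : ℕ) : ℕ∞) f := by
      rw [show m + 1 + n = m + (n + 1) by ring]; exact hf
    have h1 : ContDiff ℝ ((m + 1 : ℕ) : ℕ∞) (ladder ι n f) := ih hf'
    exact contDiff_ladderStep (hι.of_le (by exact_mod_cast le_top)) (by exact_mod_cast h1) _

/-! ### Linearity -/

/-- `ladderStep_add`. [folklore] -/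
theorem ladderStep_add {f g : ℝ → ℝ} (hf : Differentiable ℝ f) (hg : Differentiable ℝ g) (k : ℕ) :
    ladderStep ι k (fun x => f x + g x) = fun x => ladderStep ι k f x + ladderStep ι k g x := by
  funext x
  simp only [ladderStep_apply, deriv_fun_add (hf x) (hg x)]
  ring

/-- `ladderStep_sub`. [folklore] -/
theorem ladderStep_sub {f g : ℝ → ℝ} (hf : Differentiable ℝ f) (hg : Differentiable ℝ g) (k : ℕ) :
    ladderStep ι k (fun x => f x - g x) = fun x => ladderStep ι k f x - ladderStep ι k g x := by
  funext x
  simp only [ladderStep_apply, deriv_fun_sub (hf x) (hg x)]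
  ring

/-- `ladderStep_const_mul`. [folklore] -/
theorem ladderStep_const_mul (f : ℝ → ℝ) (c : ℝ) (k : ℕ) :
    ladderStep ι k (fun x => c * f x) = fun x => c * ladderStep ι k f x := by
  funext x
  simp only [ladderStep_apply, deriv_const_mul_field]
  ring

/-- `ladder_add`. [folklore] -/
theorem ladder_add (hι : ContDiff ℝ (⊤ : ℕ∞) ι) {n : ℕ} {f g : ℝ → ℝ} (hf : ContDiff ℝ n f)
    (hg : ContDiff ℝ n g) :
    ladder ι n (fun x => f x + g x) = fun x => ladder ι n f x + ladder ι n g x := by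
  induction n with
  | zero => rfl
  | succ n ih =>
    have hf1 : ContDiff ℝ ((1 + n : ℕ) : ℕ∞) f := by rw [add_comm]; exact_mod_cast hf
    have hg1 : ContDiff ℝ ((1 + n : ℕ) : ℕ∞) g := by rw [add_comm]; exact_mod_cast hg
    have hfn : ContDiff ℝ n f := hf.of_le (by exact_mod_cast Nat.le_succ n)
    have hgn : ContDiff ℝ n g := hg.of_le (by exact_mod_cast Nat.le_succ n)
    rw [ladder_succ, ih hfn hgn, ladder_succ, ladder_succ]
    exact ladderStep_add ((contDiff_ladder hι hf1).differentiable (by norm_num))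
      ((contDiff_ladder hι hg1).differentiable (by norm_num)) _

/-- `ladder_sub`. [folklore] -/
theorem ladder_sub (hι : ContDiff ℝ (⊤ : ℕ∞) ι) {n : ℕ} {f g : ℝ → ℝ} (hf : ContDiff ℝ n f)
    (hg : ContDiff ℝ n g) :
    ladder ι n (fun x => f x - g x) = fun x => ladder ι n f x - ladder ι n g x := by
  induction n with
  | zero => rfl
  | succ n ih =>
    have hf1 : ContDiff ℝ ((1 + n : ℕ) : ℕ∞) f := by rw [add_comm]; exact_mod_cast hf
    have hg1 : ContDiff ℝ ((1 + n : ℕ) : ℕ∞) g := by rw [add_comm]; exact_mod_cast hg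
    have hfn : ContDiff ℝ n f := hf.of_le (by exact_mod_cast Nat.le_succ n)
    have hgn : ContDiff ℝ n g := hg.of_le (by exact_mod_cast Nat.le_succ n)
    rw [ladder_succ, ih hfn hgn, ladder_succ, ladder_succ]
    exact ladderStep_sub ((contDiff_ladder hι hf1).differentiable (by norm_num))
      ((contDiff_ladder hι hg1).differentiable (by norm_num)) _

/-- `ladder_const_mul`. [folklore] -/
theorem ladder_const_mul (n : ℕ) (f : ℝ → ℝ) (c : ℝ) :
    ladder ι n (fun x => c * f x) = fun x => c * ladder ι n f x := by
  induction n with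
  | zero => rfl
  | succ n ih => rw [ladder_succ, ih, ladderStep_const_mul, ladder_succ]

/-! ### One-parameter families: joint regularity and differentiation in the parameter -/

/-- If `uncurry Φ ∈ C^{m+1}` and `ι ∈ C^m` then `(t, x) ↦ ladderStep ι k (Φ t) x` is `C^m`. [folklore] -/
theorem contDiff_uncurry_ladderStep {Φ : ℝ → ℝ → ℝ} {m : ℕ} (hι : ContDiff ℝ m ι)
    (hΦ : ContDiff ℝ (m + 1) (Function.uncurry Φ)) (k : ℕ) :
    ContDiff ℝ m (Function.uncurry fun t => ladderStep ι k (Φ t)) := by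
  have hfd : Differentiable ℝ (Function.uncurry Φ) := hΦ.differentiable (by norm_num)
  have hD : ContDiff ℝ m (fderiv ℝ (Function.uncurry Φ)) := hΦ.fderiv_right (by norm_cast)
  have hx : ∀ t x, deriv (Φ t) x = fderiv ℝ (Function.uncurry Φ) (t, x) (0, 1) := by
    intro t x
    have c : HasDerivAt (fun y : ℝ => (t, y)) ((0 : ℝ), (1 : ℝ)) x :=
      (hasDerivAt_const x t).prodMk (hasDerivAt_id x)
    have h := (hfd (t, x)).hasFDerivAt.comp_hasDerivAt x c
    exact h.deriv
  have h1 : ContDiff ℝ m fun p : ℝ × ℝ => fderiv ℝ (Function.uncurry Φ) p (0, 1) :=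
    hD.clm_apply contDiff_const
  have h2 : ContDiff ℝ m fun p : ℝ × ℝ => Φ p.1 p.2 := hΦ.of_le (by exact_mod_cast Nat.le_succ m)
  have h3 : ContDiff ℝ m fun p : ℝ × ℝ => ι p.2 := hι.comp contDiff_snd
  have : (Function.uncurry fun t => ladderStep ι k (Φ t))
      = fun p : ℝ × ℝ => fderiv ℝ (Function.uncurry Φ) p (0, 1) - k * ι p.2 * Φ p.1 p.2 := by
    funext p
    simp only [Function.uncurry, ladderStep_apply, hx]
  rw [this]
  exact h1.sub ((contDiff_const.mul h3).mul h2)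

/-- If `uncurry Φ ∈ C^{m+n}` and `ι ∈ C^∞` then `(t, x) ↦ ladder ι n (Φ t) x` is `C^m`. [folklore] -/
theorem contDiff_uncurry_ladder (hι : ContDiff ℝ (⊤ : ℕ∞) ι) {Φ : ℝ → ℝ → ℝ} {m n : ℕ}
    (hΦ : ContDiff ℝ ((m + n : ℕ) : ℕ∞) (Function.uncurry Φ)) :
    ContDiff ℝ m (Function.uncurry fun t => ladder ι n (Φ t)) := by
  induction n generalizing m with
  | zero => simpa using hΦ
  | succ n ih =>
    have hΦ' : ContDiff ℝ ((m + 1 + n : ℕ) : ℕ∞) (Function.uncurry Φ) := by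
      rw [show m + 1 + n = m + (n + 1) by ring]; exact hΦ
    have h1 : ContDiff ℝ ((m + 1 : ℕ) : ℕ∞) (Function.uncurry fun t => ladder ι n (Φ t)) := ih hΦ'
    exact contDiff_uncurry_ladderStep (hι.of_le (by exact_mod_cast le_top))
      (by exact_mod_cast h1) (n + 1)

/-- **Differentiation in the parameter commutes with a rung**: for `uncurry Φ ∈ C²`,
`∂ₜ (ladderStep ι k (Φ t)) (x) = ladderStep ι k (∂ₜΦ(t, ·)) (x)`. [folklore] -/
theorem deriv_ladderStep_param {Φ : ℝ → ℝ → ℝ} (hΦ : ContDiff ℝ 2 (Function.uncurry Φ)) (k : ℕ)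
    (t x : ℝ) :
    deriv (fun τ => ladderStep ι k (Φ τ) x) t
      = ladderStep ι k (fun y => deriv (fun τ => Φ τ y) t) x := by
  obtain ⟨Φt, Φx, -, Φtx, -, -, -, -, -, -, h1, h2, -, h4, h5, -, -, -⟩ :=
    Literature.Analysis.Calculus.exists_partials_of_contDiff_two hΦ
  have hL : HasDerivAt (fun τ => ladderStep ι k (Φ τ) x) (Φtx t x - k * ι x * Φt t x) t := by
    have e : (fun τ => ladderStep ι k (Φ τ) x) = fun τ => Φx τ x - k * ι x * Φ τ x := by
      funext τ; simp only [ladderStep_apply, (h2 τ x).deriv]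
    rw [e]
    exact (h4 t x).sub ((h1 t x).const_mul ((k : ℝ) * ι x))
  rw [hL.deriv, ladderStep_apply]
  have e2 : (fun y => deriv (fun τ => Φ τ y) t) = Φt t := funext fun y => (h1 t y).deriv
  rw [e2, (h5 t x).deriv, (h1 t x).deriv]

end Literature.Analysis.ODE
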